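import Mathlib
import Summits.ValiantsHypothesis.ValiantsHypothesis.Theorems.NewtonUnitEquationsTwoProductsRankOneAPLawPlanar
import Summits.ValiantsHypothesis.ValiantsHypothesis.Theorems.TwoProducts.Negative.RankOneCoverage
import HarnessLib

/-!
# `TwoProducts` (stmt-ValiantsHypothesis-5906), line `relation_ladder` — NEGATIVE lane: MEMBERSHIP TEST for R8's class `OneSidedRankOne`
# (read off one non-permutation coincidence: one excess side is a single letter)

Helper file of the Negative lane (val-neg-1 g4; `--supports stmt-ValiantsHypothesis-5906`; closes NO item).  R8 (typed target
`Cruxes/TwoProducts/Lines/relation_ladder_sketch_R8.lean`, being landed by val-lit-p3 g15 as `…RankOneOneSidedLaw*`) removes from the residual the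
families `A` satisfying `OneSidedRankOne A`: a relation `p•α = Σ q_i•β_i` (`p, q_i ≥ 1`, `k ≥ 1` distinct `β_i ≠ α`) such that every coincidence
of `A` is a `k`-shift of the datum `(Σ q_i e_{β_i}, p e_α)`.  Using the coverage theorem (`…Negative.RankOneCoverage`) this file turns that
∃-statement over witnesses into a TEST on the family, read off any one non-permutation coincidence `(a₀, b₀)`:

* `weight_msetT`, `weight_excess_eq`: the realised excess pair of a coincidence is itself a letter relation,
  `Σ_e (P ∸ Q) e • e = Σ_e (Q ∸ P) e • e`; hence (`weight_datum_eq`) so is every datum read off it.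
* `msetT_apply_zero`, `ne_zero_of_weight`: the zero letter never occurs, so both excess vectors of a non-permutation coincidence are non-zero.
* `oneSided_of_support_form`: a disjoint datum with a single-letter minus side, non-zero plus side and balanced weights IS an R8 witness
  (enumeration of the support by `Finset.equivFin`).
* `base_single_of_oneSided` / `oneSided_of_base_single` / `oneSided_iff_base` (MEMBERSHIP TEST): for a family with a non-permutation
  coincidence `(a₀, b₀)`, `OneSidedRankOne A` (stated with its body unfolded, as in the landed R8 law) holds iff SOME rank-one datum serves `A`
  and `#supp(P₀ ∸ Q₀) = 1 ∨ #supp(Q₀ ∸ P₀) = 1`.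

READING (information for the line owner, not an objection): after R8 the rank-one part of the residual is exactly «pairwise proportional
realised excess pairs with BOTH excess supports of size ≥ 2 at one (equivalently every) non-permutation coincidence» — the two-sided shapes of
memo #44 (`α+2β=γ+δ`, `α+β=γ+δ+ε`, …); the rest is realised rank ≥ 2.  Honest framing: helper lemmas only; `TwoProducts` (5906),
`ResidualLawV20` and VP ≠ VNP are NOT proved here and are not claimed. [folklore]
-/

namespace Summit.ValiantsHypothesis.Theorems.TwoProducts.Negative.OneSidedMembership

open Finset
open Summit.ValiantsHypothesis.ValiantsHypothesis.Theorems.NewtonUnitEquations.TwoProducts.FormalLogLinearisation (Expo)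
open Summit.ValiantsHypothesis.ValiantsHypothesis.Theorems.NewtonUnitEquations.TwoProducts.PlanarCell (tuples)
open Summit.ValiantsHypothesis.ValiantsHypothesis.Theorems.NewtonUnitEquations.TwoProducts.PermutationType
  (msetT RankOneCoincidences)
open Summit.ValiantsHypothesis.Theorems.TwoProducts.Negative.DatumExcess
open Summit.ValiantsHypothesis.Theorems.TwoProducts.Negative.RankOneCoverage

variable {m : ℕ}

/-! ### Weights -/

/-- The weight `Σ_e n_e • e` of the letter multiset of a tuple is the tuple's sum. [folklore] -/
theorem weight_msetT (a : Fin m → Expo) : (msetT a).sum (fun e n => n • e) = ∑ j, a j := by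
  classical
  unfold msetT
  rw [← Finsupp.sum_finsetSum_index (fun e => zero_smul ℕ e) (fun e n₁ n₂ => add_smul n₁ n₂ e)]
  refine Finset.sum_congr rfl fun j _ => ?_
  by_cases h : a j = 0
  · rw [if_pos h, h, Finsupp.sum_zero_index]
  · rw [if_neg h, Finsupp.sum_single_index (h := fun e n => n • e) (zero_smul ℕ (a j)), one_smul]

/-- Weights are additive. [folklore] -/
theorem weight_add (X Y : Expo →₀ ℕ) :
    (X + Y).sum (fun e n => n • e) = X.sum (fun e n => n • e) + Y.sum (fun e n => n • e) :=
  Finsupp.sum_add_index' (fun e => zero_smul ℕ e) (fun e n₁ n₂ => add_smul n₁ n₂ e)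

/-- Weights are homogeneous. [folklore] -/
theorem weight_smul (G : ℕ) (X : Expo →₀ ℕ) : (G • X).sum (fun e n => n • e) = G • X.sum (fun e n => n • e) := by
  rw [Finsupp.sum_smul_index (fun e => zero_smul ℕ e)]
  simp_rw [mul_smul]
  exact Finsupp.smul_sum.symm

/-- **The realised excess pair is a letter relation.**  For a coincidence `Σ a = Σ b`:
`Σ_e (P ∸ Q) e • e = Σ_e (Q ∸ P) e • e`. [folklore] -/
theorem weight_excess_eq {a b : Fin m → Expo} (hab : ∑ j, a j = ∑ j, b j) :
    (msetT a - msetT b).sum (fun e n => n • e) = (msetT b - msetT a).sum (fun e n => n • e) := by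
  have hPQ : msetT a + (msetT b - msetT a) = msetT b + (msetT a - msetT b) := by
    refine Finsupp.ext fun e => ?_
    simp only [Finsupp.add_apply, Finsupp.tsub_apply]
    omega
  have hW := congrArg (fun X : Expo →₀ ℕ => X.sum (fun e n => n • e)) hPQ
  simp only [weight_add, weight_msetT, hab] at hW
  refine Finsupp.ext fun c => ?_
  have := DFunLike.congr_fun hW c
  simp only [Finsupp.add_apply] at this
  omega

/-- A datum read off a coincidence is balanced: `G • ρ⁻ = P ∸ Q`, `G • ρ⁺ = Q ∸ P`, `G ≠ 0` give `Σ ρ⁻ e • e = Σ ρ⁺ e • e`. [folklore] -/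
theorem weight_datum_eq {P Q ρp ρm : Expo →₀ ℕ} {G : ℕ} (hG : G ≠ 0) (hm : P - Q = G • ρm) (hp : Q - P = G • ρp)
    (hW : (P - Q).sum (fun e n => n • e) = (Q - P).sum (fun e n => n • e)) :
    ρm.sum (fun e n => n • e) = ρp.sum (fun e n => n • e) := by
  rw [hm, hp, weight_smul, weight_smul] at hW
  refine Finsupp.ext fun c => ?_
  have := DFunLike.congr_fun hW c
  simp only [Finsupp.smul_apply, smul_eq_mul] at this
  exact Nat.eq_of_mul_eq_mul_left (Nat.pos_of_ne_zero hG) this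

/-! ### The zero letter never occurs -/

/-- `msetT` ignores the zero letter. [folklore] -/
theorem msetT_apply_zero (a : Fin m → Expo) : msetT a 0 = 0 := by
  classical
  unfold msetT
  rw [Finsupp.finsetSum_apply]
  refine Finset.sum_eq_zero fun j _ => ?_
  by_cases h : a j = 0
  · rw [if_pos h]; rfl
  · rw [if_neg h, Finsupp.single_apply, if_neg h]

/-- A non-zero letter vector supported inside a letter multiset has non-zero weight partner: if `supp X ⊆ supp (msetT a)`, `X ≠ 0` and
`Σ X e • e = Σ Y e • e`, then `Y ≠ 0`. [folklore] -/
theorem ne_zero_of_weight {X Y : Expo →₀ ℕ} {a : Fin m → Expo} (hXa : X.support ⊆ (msetT a).support) (hX : X ≠ 0)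
    (hw : X.sum (fun e n => n • e) = Y.sum (fun e n => n • e)) : Y ≠ 0 := by
  classical
  rintro rfl
  rw [Finsupp.sum_zero_index] at hw
  obtain ⟨e₀, he₀⟩ := Finsupp.support_nonempty_iff.2 hX
  have he₀0 : e₀ ≠ 0 := by
    rintro rfl
    exact Finsupp.mem_support_iff.1 (hXa he₀) (msetT_apply_zero a)
  obtain ⟨c, hc⟩ : ∃ c, e₀ c ≠ 0 := by
    by_contra! h
    exact he₀0 (Finsupp.ext fun c => by simpa using h c)
  have hsum : (X.sum fun e n => n • e) c = 0 := by rw [hw]; rfl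
  rw [Finsupp.sum, Finsupp.finsetSum_apply, Finset.sum_eq_zero_iff] at hsum
  have := hsum e₀ he₀
  rw [Finsupp.smul_apply, smul_eq_mul] at this
  exact (Nat.mul_eq_zero.1 this).elim (Finsupp.mem_support_iff.1 he₀) hc

/-! ### From the support form to an R8 witness -/

/-- **Support form ⇒ R8 witness.**  A disjoint datum `(ρ⁺, ρ⁻)` with single-letter `ρ⁻`, non-zero `ρ⁺` and balanced weights is,
after enumerating `supp ρ⁺`, literally a one-sided rank-one witness `p•α = Σ q_i•β_i`. [folklore] -/
theorem oneSided_of_support_form {A : Fin m → Finset Expo} {ρp ρm : Expo →₀ ℕ} (h : RankOneCoincidences A ρp ρm)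
    (hdis : ∀ e, ρp e = 0 ∨ ρm e = 0) (hm : #ρm.support = 1) (hp : ρp ≠ 0)
    (hw : ρm.sum (fun e n => n • e) = ρp.sum (fun e n => n • e)) :
    ∃ (α : Expo) (p k : ℕ) (β : Fin k → Expo) (q : Fin k → ℕ), 1 ≤ p ∧ 1 ≤ k ∧ (∀ i, 1 ≤ q i) ∧ Function.Injective β ∧
      (∀ i, β i ≠ α) ∧ p • α = ∑ i, q i • β i ∧
      RankOneCoincidences A (∑ i, Finsupp.single (β i) (q i)) (Finsupp.single α p) := by
  classical
  obtain ⟨α, hα⟩ := Finset.card_eq_one.1 hm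
  have hαmem : α ∈ ρm.support := by rw [hα]; exact mem_singleton_self α
  have hρm : ρm = Finsupp.single α (ρm α) := by
    rw [Finsupp.eq_single_iff]
    exact ⟨by rw [hα], rfl⟩
  have hWm : ρm.sum (fun e n => n • e) = ρm α • α := by
    conv_lhs => rw [hρm]
    exact Finsupp.sum_single_index (h := fun e n => n • e) (zero_smul ℕ α)
  have hmem : ∀ i : Fin #ρp.support, ((ρp.support.equivFin.symm i : ρp.support) : Expo) ∈ ρp.support :=
    fun i => (ρp.support.equivFin.symm i).2
  have hsingle : ∑ i : Fin #ρp.support, Finsupp.single ((ρp.support.equivFin.symm i : ρp.support) : Expo)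
      (ρp ((ρp.support.equivFin.symm i : ρp.support) : Expo)) = ρp := by
    rw [Equiv.sum_comp ρp.support.equivFin.symm (fun x : ρp.support => Finsupp.single (x : Expo) (ρp x)),
      Finset.sum_coe_sort ρp.support (fun x => Finsupp.single x (ρp x))]
    exact ρp.sum_single
  have hweight : ∑ i : Fin #ρp.support, ρp ((ρp.support.equivFin.symm i : ρp.support) : Expo) •
      ((ρp.support.equivFin.symm i : ρp.support) : Expo) = ρp.sum (fun e n => n • e) := by
    rw [Equiv.sum_comp ρp.support.equivFin.symm (fun x : ρp.support => ρp x • (x : Expo)),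
      Finset.sum_coe_sort ρp.support (fun x => ρp x • x)]
    rfl
  refine ⟨α, ρm α, #ρp.support, fun i => ((ρp.support.equivFin.symm i : ρp.support) : Expo),
    fun i => ρp ((ρp.support.equivFin.symm i : ρp.support) : Expo), ?_, ?_, ?_, ?_, ?_, ?_, ?_⟩
  · exact Nat.one_le_iff_ne_zero.2 (Finsupp.mem_support_iff.1 hαmem)
  · exact Finset.card_pos.2 (Finsupp.support_nonempty_iff.2 hp)
  · exact fun i => Nat.one_le_iff_ne_zero.2 (Finsupp.mem_support_iff.1 (hmem i))
  · exact fun i j hij => ρp.support.equivFin.symm.injective (Subtype.ext hij)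
  · intro i hia
    have h1 : ρp α ≠ 0 := by rw [← hia]; exact Finsupp.mem_support_iff.1 (hmem i)
    have h2 : ρm α ≠ 0 := Finsupp.mem_support_iff.1 hαmem
    rcases hdis α with h0 | h0
    · exact h1 h0
    · exact h2 h0
  · rw [hweight, ← hw, hWm]
  · rw [hsingle, ← hρm]
    exact h

/-! ### The membership test -/

/-- `OneSidedRankOne A` (body unfolded) ⇒ some datum serves `A`, and at every non-permutation coincidence one excess side is a single
letter. [folklore] -/
theorem base_single_of_oneSided {A : Fin m → Finset Expo}
    (hO : ∃ (α : Expo) (p k : ℕ) (β : Fin k → Expo) (q : Fin k → ℕ), 1 ≤ p ∧ 1 ≤ k ∧ (∀ i, 1 ≤ q i) ∧ Function.Injective β ∧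
      (∀ i, β i ≠ α) ∧ p • α = ∑ i, q i • β i ∧
      RankOneCoincidences A (∑ i, Finsupp.single (β i) (q i)) (Finsupp.single α p))
    {a₀ b₀ : Fin m → Expo} (ha₀ : a₀ ∈ tuples A) (hb₀ : b₀ ∈ tuples A) (hab₀ : ∑ j, a₀ j = ∑ j, b₀ j)
    (hne₀ : msetT a₀ ≠ msetT b₀) :
    (∃ ρp ρm : Expo →₀ ℕ, RankOneCoincidences A ρp ρm) ∧
      (#(msetT a₀ - msetT b₀).support = 1 ∨ #(msetT b₀ - msetT a₀).support = 1) := by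
  classical
  obtain ⟨α, p, k, β, q, hp, -, -, -, hβα, -, hR⟩ := hO
  refine ⟨⟨_, _, hR⟩, ?_⟩
  have hdis : ∀ e, (∑ i, Finsupp.single (β i) (q i)) e = 0 ∨ (Finsupp.single α p) e = 0 := by
    intro e
    by_cases he : e = α
    · left
      subst he
      rw [Finsupp.finsetSum_apply]
      exact Finset.sum_eq_zero fun i _ => by rw [Finsupp.single_apply, if_neg (hβα i)]
    · right
      rw [Finsupp.single_apply, if_neg (Ne.symm he)]
  have hsupp : (Finsupp.single α p).support = {α} := Finsupp.support_single α (by omega)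
  obtain ⟨k', hk' | hk'⟩ := hR a₀ ha₀ b₀ hb₀ hab₀
  · left
    rw [(support_eq_of_shift_disjoint hk' hdis hne₀).1, hsupp, card_singleton]
  · right
    rw [(support_eq_of_shift_disjoint hk' hdis (Ne.symm hne₀)).1, hsupp, card_singleton]

/-- Some datum serves `A` and one excess side of a non-permutation coincidence `(a₀, b₀)` is a single letter ⇒ `OneSidedRankOne A`
(body unfolded). [folklore] -/
theorem oneSided_of_base_single {A : Fin m → Finset Expo} (hD : ∃ ρp ρm : Expo →₀ ℕ, RankOneCoincidences A ρp ρm)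
    {a₀ b₀ : Fin m → Expo} (ha₀ : a₀ ∈ tuples A) (hb₀ : b₀ ∈ tuples A) (hab₀ : ∑ j, a₀ j = ∑ j, b₀ j)
    (hne₀ : msetT a₀ ≠ msetT b₀) (h1 : #(msetT a₀ - msetT b₀).support = 1 ∨ #(msetT b₀ - msetT a₀).support = 1) :
    ∃ (α : Expo) (p k : ℕ) (β : Fin k → Expo) (q : Fin k → ℕ), 1 ≤ p ∧ 1 ≤ k ∧ (∀ i, 1 ≤ q i) ∧ Function.Injective β ∧
      (∀ i, β i ≠ α) ∧ p • α = ∑ i, q i • β i ∧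
      RankOneCoincidences A (∑ i, Finsupp.single (β i) (q i)) (Finsupp.single α p) := by
  classical
  obtain ⟨ρp, ρm, h⟩ := hD
  obtain ⟨G, ρp', ρm', hG, hm, hp, hR⟩ := exists_base_datum_of_rankOne h ha₀ hb₀ hab₀ hne₀
  have evm : ∀ e, (msetT a₀ - msetT b₀) e = G * ρm' e := fun e => by
    have := DFunLike.congr_fun hm e
    simpa only [Finsupp.smul_apply, smul_eq_mul] using this
  have evp : ∀ e, (msetT b₀ - msetT a₀) e = G * ρp' e := fun e => by
    have := DFunLike.congr_fun hp e
    simpa only [Finsupp.smul_apply, smul_eq_mul] using this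
  have hdis' : ∀ e, ρp' e = 0 ∨ ρm' e = 0 := by
    intro e
    rcases reduce_disjoint (msetT a₀) (msetT b₀) e with h0 | h0
    · right
      rw [evm e] at h0
      exact (Nat.mul_eq_zero.1 h0).resolve_left hG
    · left
      rw [evp e] at h0
      exact (Nat.mul_eq_zero.1 h0).resolve_left hG
  have hw' : ρm'.sum (fun e n => n • e) = ρp'.sum (fun e n => n • e) :=
    weight_datum_eq hG hm hp (weight_excess_eq hab₀)
  have suppm : ρm'.support = (msetT a₀ - msetT b₀).support := by
    ext e
    simp only [Finsupp.mem_support_iff, evm e, ne_eq, Nat.mul_eq_zero, hG, false_or]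
  have suppp : ρp'.support = (msetT b₀ - msetT a₀).support := by
    ext e
    simp only [Finsupp.mem_support_iff, evp e, ne_eq, Nat.mul_eq_zero, hG, false_or]
  have subm : ρm'.support ⊆ (msetT a₀).support := by
    rw [suppm]
    intro e he
    rw [Finsupp.mem_support_iff] at he ⊢
    rw [Finsupp.tsub_apply] at he
    omega
  have subp : ρp'.support ⊆ (msetT b₀).support := by
    rw [suppp]
    intro e he
    rw [Finsupp.mem_support_iff] at he ⊢
    rw [Finsupp.tsub_apply] at he
    omega
  rcases h1 with h1 | h1
  · have hm1 : #ρm'.support = 1 := by rw [suppm]; exact h1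
    have hm0 : ρm' ≠ 0 := by
      rw [← Finsupp.support_nonempty_iff, ← Finset.card_pos, hm1]; exact Nat.one_pos
    exact oneSided_of_support_form hR hdis' hm1 (ne_zero_of_weight subm hm0 hw') hw'
  · have hp1 : #ρp'.support = 1 := by rw [suppp]; exact h1
    have hp0 : ρp' ≠ 0 := by
      rw [← Finsupp.support_nonempty_iff, ← Finset.card_pos, hp1]; exact Nat.one_pos
    exact oneSided_of_support_form
      (Summit.ValiantsHypothesis.ValiantsHypothesis.Theorems.NewtonUnitEquations.TwoProducts.PermutationType.R6c.rankOneCoincidences_symm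
        A ρp' ρm' hR)
      (fun e => (hdis' e).symm) hp1 (ne_zero_of_weight subp hp0 hw'.symm) hw'.symm

/-- **Membership test for R8's class.**  For a family with a non-permutation coincidence `(a₀, b₀)`: `OneSidedRankOne A` (body unfolded)
iff some rank-one datum serves `A` and `#supp(P₀ ∸ Q₀) = 1 ∨ #supp(Q₀ ∸ P₀) = 1`. [folklore] -/
theorem oneSided_iff_base {A : Fin m → Finset Expo} {a₀ b₀ : Fin m → Expo} (ha₀ : a₀ ∈ tuples A) (hb₀ : b₀ ∈ tuples A)
    (hab₀ : ∑ j, a₀ j = ∑ j, b₀ j) (hne₀ : msetT a₀ ≠ msetT b₀) :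
    (∃ (α : Expo) (p k : ℕ) (β : Fin k → Expo) (q : Fin k → ℕ), 1 ≤ p ∧ 1 ≤ k ∧ (∀ i, 1 ≤ q i) ∧ Function.Injective β ∧
      (∀ i, β i ≠ α) ∧ p • α = ∑ i, q i • β i ∧
      RankOneCoincidences A (∑ i, Finsupp.single (β i) (q i)) (Finsupp.single α p)) ↔
    (∃ ρp ρm : Expo →₀ ℕ, RankOneCoincidences A ρp ρm) ∧
      (#(msetT a₀ - msetT b₀).support = 1 ∨ #(msetT b₀ - msetT a₀).support = 1) :=
  ⟨fun hO => base_single_of_oneSided hO ha₀ hb₀ hab₀ hne₀, fun h => oneSided_of_base_single h.1 ha₀ hb₀ hab₀ hne₀ h.2⟩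

end Summit.ValiantsHypothesis.Theorems.TwoProducts.Negative.OneSidedMembership
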